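import Summits.CriticalPhenomena.PercolationContinuityZ3.Theorems.PercNearOneGluingNoHeavyLowerTailSunflowerTBernMerge
import HarnessLib

/-!
# `NoHeavyLowerTail` (crux stmt-CriticalPhenomena-4575), abstract sunflower cubic: T-BERN — the two EXCHANGE MOVES of the
# reduction (u-exchange between two slack petals; joint scaling of two petals) and their convexity

Support file (seat `prim-ineq-prove-1` gen 65; `--supports stmt-CriticalPhenomena-4575`).  No `sorry`, no named facts.
Memo: run/shared/lean/prim/prim-ineq-prove-1/FINDING-REDUCTION-prove1-g65.md §1 (steps R1, R2).

Both moves are one-parameter deformations `τ ↦ family(τ)` of an admissible family that keep the three budgets EXACTLY and under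
which every coefficient of the family polynomial has the form `p + q·τ + r/τ` with `q, r ≥ 0` (the two moved petals contribute
factors affine in `τ` resp. in `1/τ`, the others are unchanged): such a function on an interval `[τ_lo, τ_hi] ∋ 1` is bounded by
its larger endpoint value (`pqr_le_max`).  So a coefficient of the original family (`τ = 1`) is at most the same coefficient of
one of the two endpoint families (`coeff_uExchange_le_max`, `coeff_scale_le_max`), and the endpoint families are admissible
(`admissibleOn_uExchange`, `admissibleOn_scale`) with one more "tightness":
* u-exchange `u_i ↦ u_iτ`, `u_j ↦ u_j/τ` between two SLACK petals (`m < u`): at `τ = m_i/u_i` resp. `τ = u_j/m_j` one of them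
  becomes tight;
* scaling `(u,vv,m)_i ↦ τ·(u,vv,m)_i`, `(u,vv,m)_j ↦ (u,vv,m)_j/τ`: at `τ = max(b/m_i, β/vv_i)` resp. `τ = 1/max(b/m_j, β/vv_j)` one
  of them reaches `m = b` or `vv = β`.
The per-petal caps `u ≤ 1`, `vv ≤ V` are never an obstruction: they follow from the budgets (`le_cap_of_prod_le`).
-/

noncomputable section

namespace Summit.CriticalPhenomena.PercolationContinuityZ3.Theorems.SunflowerPartition

namespace SafeCalc

namespace LinkedCurrency

open Finset Polynomial

variable {ι : Type*}

/-! ## `p + qτ + r/τ` is maximal at an endpoint -/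

/-- For `r ≥ 0` and `0 < τ_lo ≤ 1 ≤ τ_hi`: `p + q + r ≤ max (p + qτ_lo + r/τ_lo) (p + qτ_hi + r/τ_hi)` (convexity of
`τ ↦ qτ + r/τ`). [this work] -/
theorem pqr_le_max {p q r tlo thi : ℝ} (hr : 0 ≤ r) (hlo : 0 < tlo) (hlo1 : tlo ≤ 1) (hhi : 1 ≤ thi) :
    p + q + r ≤ max (p + q * tlo + r / tlo) (p + q * thi + r / thi) := by
  have hthi : 0 < thi := lt_of_lt_of_le zero_lt_one hhi
  rcases le_or_gt (r / thi) q with h | h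
  · refine le_trans ?_ (le_max_right _ _)
    have e : (thi - 1) * (q - r / thi) = q * thi + r / thi - q - r := by field_simp; ring
    have : 0 ≤ (thi - 1) * (q - r / thi) := mul_nonneg (sub_nonneg.2 hhi) (sub_nonneg.2 h)
    linarith
  · refine le_trans ?_ (le_max_left _ _)
    have h1 : r / thi ≤ r := div_le_self hr hhi
    have h2 : r ≤ r / tlo := le_div_self hr hlo hlo1
    have e : (1 - tlo) * (r / tlo - q) = q * tlo + r / tlo - q - r := by field_simp; ring
    have : 0 ≤ (1 - tlo) * (r / tlo - q) := mul_nonneg (sub_nonneg.2 hlo1) (by linarith)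
    linarith

/-! ## Coefficients of `(quadratic) × R` -/

/-- The product of two linear polynomials as an explicit quadratic. [this work] -/
theorem lin_mul_lin (A G a c : ℝ) :
    (C A * X + C G) * (C a * X + C c) = C (A * a) * X ^ 2 + C (A * c + G * a) * X + C (G * c) := by
  simp only [C_mul, C_add]
  ring

/-- The coefficients of `(a₂X² + a₁X + a₀)·R` are linear in `(a₂, a₁, a₀)` with nonnegative weights when `R ≥_coef 0`.
[this work] -/
theorem coeff_quad_mul (a2 a1 a0 : ℝ) (R : ℝ[X]) (k : ℕ) :
    ((C a2 * X ^ 2 + C a1 * X + C a0) * R).coeff k =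
      a2 * (if 2 ≤ k then R.coeff (k - 2) else 0) + a1 * (if 1 ≤ k then R.coeff (k - 1) else 0) + a0 * R.coeff k := by
  have e : (C a2 * X ^ 2 + C a1 * X + C a0) * R = C a2 * (X ^ 2 * R) + C a1 * (X ^ 1 * R) + C a0 * R := by ring
  rw [e, coeff_add, coeff_add, coeff_C_mul, coeff_C_mul, coeff_C_mul, coeff_X_pow_mul', coeff_X_pow_mul']

/-- **Endpoint bound for `p + qτ + r/τ` coefficients.**  If the three coefficients of the quadratic factor are of the form
`p_m + q_m τ + r_m/τ` (`r_m ≥ 0`) and `R ≥_coef 0`, then the `k`-th coefficient at `τ = 1` is at most the larger of the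
`k`-th coefficients at `τ_lo` and `τ_hi` (`0 < τ_lo ≤ 1 ≤ τ_hi`). [this work] -/
theorem coeff_quad_mul_le_max {R : ℝ[X]} (hR : CoefNonneg R) (k : ℕ) {p2 q2 r2 p1 q1 r1 p0 q0 r0 tlo thi : ℝ}
    (hr2 : 0 ≤ r2) (hr1 : 0 ≤ r1) (hr0 : 0 ≤ r0) (hlo : 0 < tlo) (hlo1 : tlo ≤ 1) (hhi : 1 ≤ thi) :
    ((C (p2 + q2 + r2) * X ^ 2 + C (p1 + q1 + r1) * X + C (p0 + q0 + r0)) * R).coeff k ≤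
      max (((C (p2 + q2 * tlo + r2 / tlo) * X ^ 2 + C (p1 + q1 * tlo + r1 / tlo) * X +
              C (p0 + q0 * tlo + r0 / tlo)) * R).coeff k)
          (((C (p2 + q2 * thi + r2 / thi) * X ^ 2 + C (p1 + q1 * thi + r1 / thi) * X +
              C (p0 + q0 * thi + r0 / thi)) * R).coeff k) := by
  rw [coeff_quad_mul, coeff_quad_mul, coeff_quad_mul]
  set c2 := (if 2 ≤ k then R.coeff (k - 2) else 0) with hc2
  set c1 := (if 1 ≤ k then R.coeff (k - 1) else 0) with hc1
  set c0 := R.coeff k with hc0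
  have hc2' : 0 ≤ c2 := by rw [hc2]; split_ifs; exacts [hR _, le_rfl]
  have hc1' : 0 ≤ c1 := by rw [hc1]; split_ifs; exacts [hR _, le_rfl]
  have hc0' : 0 ≤ c0 := hR _
  have e0 : (p2 + q2 + r2) * c2 + (p1 + q1 + r1) * c1 + (p0 + q0 + r0) * c0 =
      (p2 * c2 + p1 * c1 + p0 * c0) + (q2 * c2 + q1 * c1 + q0 * c0) + (r2 * c2 + r1 * c1 + r0 * c0) := by ring
  have elo : (p2 + q2 * tlo + r2 / tlo) * c2 + (p1 + q1 * tlo + r1 / tlo) * c1 + (p0 + q0 * tlo + r0 / tlo) * c0 =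
      (p2 * c2 + p1 * c1 + p0 * c0) + (q2 * c2 + q1 * c1 + q0 * c0) * tlo + (r2 * c2 + r1 * c1 + r0 * c0) / tlo := by
    field_simp; ring
  have ehi : (p2 + q2 * thi + r2 / thi) * c2 + (p1 + q1 * thi + r1 / thi) * c1 + (p0 + q0 * thi + r0 / thi) * c0 =
      (p2 * c2 + p1 * c1 + p0 * c0) + (q2 * c2 + q1 * c1 + q0 * c0) * thi + (r2 * c2 + r1 * c1 + r0 * c0) / thi := by
    have : thi ≠ 0 := by linarith
    field_simp; ring
  rw [e0, elo, ehi]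
  exact pqr_le_max (by positivity) hlo hlo1 hhi

/-! ## Caps from budgets -/

/-- If all `f_l ≥ b > 0` on `t` and `∏ f ≤ b^(|t|−1)·V`, then each `f_k ≤ V`. [this work] -/
theorem le_cap_of_prod_le [DecidableEq ι] {t : Finset ι} {f : ι → ℝ} {b V : ℝ} (hb : 0 < b) (hf : ∀ l ∈ t, b ≤ f l)
    (hprod : ∏ l ∈ t, f l ≤ b ^ (t.card - 1) * V) {k : ι} (hk : k ∈ t) : f k ≤ V := by
  have hsplit := mul_prod_erase t f hk
  have hrest : b ^ (t.card - 1) ≤ ∏ l ∈ t.erase k, f l := by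
    rw [← card_erase_of_mem hk]
    calc b ^ (t.erase k).card = ∏ l ∈ t.erase k, b := by rw [prod_const]
      _ ≤ ∏ l ∈ t.erase k, f l := prod_le_prod (fun _ _ => hb.le) fun l hl => hf l (mem_of_mem_erase hl)
  have hpow : 0 < b ^ (t.card - 1) := pow_pos hb _
  have hfk : 0 ≤ f k := hb.le.trans (hf k hk)
  have h1 : f k * b ^ (t.card - 1) ≤ b ^ (t.card - 1) * V := by
    calc f k * b ^ (t.card - 1) ≤ f k * ∏ l ∈ t.erase k, f l := mul_le_mul_of_nonneg_left hrest hfk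
      _ = ∏ l ∈ t, f l := hsplit
      _ ≤ b ^ (t.card - 1) * V := hprod
  have h2 : f k * b ^ (t.card - 1) ≤ V * b ^ (t.card - 1) := by linarith
  exact le_of_mul_le_mul_right h2 hpow

/-! ## The u-exchange between two slack petals -/

/-- The u-exchange: `u_i ↦ u_i·τ`, `u_j ↦ u_j/τ`. [definition-free helper: the updated function] -/
theorem uExchange_apply_other {u : ι → ℝ} [DecidableEq ι] {i j l : ι} (τ : ℝ) (hli : l ≠ i) (hlj : l ≠ j) :
    Function.update (Function.update u i (u i * τ)) j (u j / τ) l = u l := by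
  rw [Function.update_of_ne hlj, Function.update_of_ne hli]

/-- **The u-exchange keeps admissibility** as long as both moved petals stay slack-feasible:
`m_i ≤ u_iτ`, `m_jτ ≤ u_j`, `τ > 0`. [this work] -/
theorem admissibleOn_uExchange [DecidableEq ι] {s b β V : ℝ} (hb : 0 < b) {t : Finset ι} {u vv m : ι → ℝ}
    (hadm : AdmissibleOn s b β V t u vv m) {i j : ι} (hij : i ≠ j) (hi : i ∈ t) (hj : j ∈ t) {τ : ℝ} (hτ : 0 < τ)
    (hmi : m i ≤ u i * τ) (hmj : m j * τ ≤ u j) :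
    AdmissibleOn s b β V t (Function.update (Function.update u i (u i * τ)) j (u j / τ)) vv m := by
  obtain ⟨hub, hu1, hvβ, hv1, hmb, hmu, hmv, hpu, hpv, hpg⟩ := hadm
  set u' := Function.update (Function.update u i (u i * τ)) j (u j / τ) with hu'
  have hu'i : u' i = u i * τ := by rw [hu', Function.update_of_ne hij, Function.update_self]
  have hu'j : u' j = u j / τ := by rw [hu', Function.update_self]
  have hu'o : ∀ l, l ≠ i → l ≠ j → u' l = u l := fun l hli hlj => uExchange_apply_other τ hli hlj
  have hmj' : m j ≤ u j / τ := by rw [le_div_iff₀ hτ]; exact hmj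
  -- pointwise: m ≤ u' (hence b ≤ u')
  have hmu' : ∀ l ∈ t, m l ≤ u' l := by
    intro l hl
    by_cases hli : l = i
    · rw [hli, hu'i]; exact hmi
    by_cases hlj : l = j
    · rw [hlj, hu'j]; exact hmj'
    rw [hu'o l hli hlj]; exact hmu l hl
  have hub' : ∀ l ∈ t, b ≤ u' l := fun l hl => (hmb l hl).trans (hmu' l hl)
  -- the u-product is unchanged
  have hprod : ∏ l ∈ t, u' l = ∏ l ∈ t, u l := by
    have hjt : j ∈ t.erase i := mem_erase.2 ⟨hij.symm, hj⟩
    rw [← mul_prod_erase t u' hi, ← mul_prod_erase (t.erase i) u' hjt, ← mul_prod_erase t u hi,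
      ← mul_prod_erase (t.erase i) u hjt, hu'i, hu'j]
    have hrest : ∏ l ∈ (t.erase i).erase j, u' l = ∏ l ∈ (t.erase i).erase j, u l :=
      prod_congr rfl fun l hl => hu'o l (mem_erase.1 (mem_of_mem_erase hl)).1 (mem_erase.1 hl).1
    rw [hrest]
    field_simp
  have hpu' : ∏ l ∈ t, u' l ≤ b ^ (t.card - 1) := by rw [hprod]; exact hpu
  refine ⟨hub', ?_, hvβ, hv1, hmb, hmu', hmv, hpu', hpv, hpg⟩
  intro l hl
  exact le_cap_of_prod_le hb hub' (by rw [mul_one]; exact hpu') hl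

/-- **The u-exchange: a coefficient at `τ = 1` is at most the larger of the coefficients at the endpoints.** [this work] -/
theorem coeff_uExchange_le_max [DecidableEq ι] {s : ℝ} (hs0 : 0 ≤ s) (hs1 : s ≤ 1) {t : Finset ι} {u c : ι → ℝ}
    (hu : ∀ l ∈ t, 0 ≤ u l) (hc : ∀ l ∈ t, 0 ≤ c l) {i j : ι} (hij : i ≠ j) (hi : i ∈ t) (hj : j ∈ t)
    {tlo thi : ℝ} (hlo : 0 < tlo) (hlo1 : tlo ≤ 1) (hhi : 1 ≤ thi) (k : ℕ) :
    (prodPoly t (fun l => s + (1 - s) * u l) c).coeff k ≤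
      max ((prodPoly t (fun l => s + (1 - s) * Function.update (Function.update u i (u i * tlo)) j (u j / tlo) l) c).coeff k)
        ((prodPoly t (fun l => s + (1 - s) * Function.update (Function.update u i (u i * thi)) j (u j / thi) l) c).coeff k) := by
  have hs' : 0 ≤ 1 - s := sub_nonneg.2 hs1
  have hjt : j ∈ t.erase i := mem_erase.2 ⟨hij.symm, hj⟩
  have hit : i ∉ t.erase i := notMem_erase i t
  have hjt' : j ∉ (t.erase i).erase j := notMem_erase j _
  set R := prodPoly ((t.erase i).erase j) (fun l => s + (1 - s) * u l) c with hRd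
  have hR : CoefNonneg R := coefNonneg_prodPoly _
    (fun l hl => add_nonneg hs0 (mul_nonneg hs' (hu l (mem_of_mem_erase (mem_of_mem_erase hl)))))
    (fun l hl => hc l (mem_of_mem_erase (mem_of_mem_erase hl)))
  -- factorization of the three families
  have fac : ∀ τ : ℝ, τ ≠ 0 →
      prodPoly t (fun l => s + (1 - s) * Function.update (Function.update u i (u i * τ)) j (u j / τ) l) c =
        (C ((s ^ 2 + (1 - s) ^ 2 * (u i * u j)) + s * (1 - s) * u i * τ + s * (1 - s) * u j / τ) * X ^ 2 +
          C ((s * c j + s * c i) + (1 - s) * u i * c j * τ + (1 - s) * u j * c i / τ) * X +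
          C (c i * c j + 0 * τ + 0 / τ)) * R := by
    intro τ hτ
    set u' := Function.update (Function.update u i (u i * τ)) j (u j / τ) with hu'
    have hu'i : u' i = u i * τ := by rw [hu', Function.update_of_ne hij, Function.update_self]
    have hu'j : u' j = u j / τ := by rw [hu', Function.update_self]
    have hrest : prodPoly ((t.erase i).erase j) (fun l => s + (1 - s) * u' l) c = R :=
      prodPoly_congr (fun l hl => by
        rw [hu', uExchange_apply_other τ (mem_erase.1 (mem_of_mem_erase hl)).1 (mem_erase.1 hl).1]) (fun _ _ => rfl)
    rw [← insert_erase hi, prodPoly_insert hit, ← insert_erase hjt, prodPoly_insert hjt', hrest, ← mul_assoc,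
      lin_mul_lin, hu'i, hu'j]
    have e2 : (s + (1 - s) * (u i * τ)) * (s + (1 - s) * (u j / τ)) =
        (s ^ 2 + (1 - s) ^ 2 * (u i * u j)) + s * (1 - s) * u i * τ + s * (1 - s) * u j / τ := by
      field_simp; ring
    have e1 : (s + (1 - s) * (u i * τ)) * c j + c i * (s + (1 - s) * (u j / τ)) =
        (s * c j + s * c i) + (1 - s) * u i * c j * τ + (1 - s) * u j * c i / τ := by
      field_simp; ring
    have e0 : c i * c j = c i * c j + 0 * τ + 0 / τ := by ring
    rw [e2, e1, ← e0]
  have fac1 : prodPoly t (fun l => s + (1 - s) * u l) c =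
      (C ((s ^ 2 + (1 - s) ^ 2 * (u i * u j)) + s * (1 - s) * u i + s * (1 - s) * u j) * X ^ 2 +
        C ((s * c j + s * c i) + (1 - s) * u i * c j + (1 - s) * u j * c i) * X + C (c i * c j + 0 + 0)) * R := by
    have h := fac 1 one_ne_zero
    simp only [mul_one, div_one] at h
    have hu1 : Function.update (Function.update u i (u i)) j (u j) = u := by
      rw [Function.update_eq_self, Function.update_eq_self]
    rw [hu1] at h
    exact h
  rw [fac1, fac tlo hlo.ne', fac thi (by linarith)]
  exact coeff_quad_mul_le_max hR k (mul_nonneg (mul_nonneg hs0 hs') (hu j hj))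
    (mul_nonneg (mul_nonneg hs' (hu j hj)) (hc i hi)) le_rfl hlo hlo1 hhi

/-! ## The joint scaling of two petals -/

/-- **The scaling move keeps admissibility**: petal `i` scaled by `τ`, petal `j` by `1/τ`, as long as
`b ≤ m_iτ`, `β ≤ vv_iτ`, `bτ ≤ m_j`, `βτ ≤ vv_j`, `τ > 0`. [this work] -/
theorem admissibleOn_scale [DecidableEq ι] {s b β V : ℝ} (hb : 0 < b) (hbβ : b ≤ β) {t : Finset ι} {u vv m : ι → ℝ}
    (hadm : AdmissibleOn s b β V t u vv m) {i j : ι} (hij : i ≠ j) (hi : i ∈ t) (hj : j ∈ t) {τ : ℝ} (hτ : 0 < τ)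
    (hmi : b ≤ m i * τ) (hvi : β ≤ vv i * τ) (hmj : b * τ ≤ m j) (hvj : β * τ ≤ vv j) :
    AdmissibleOn s b β V t (Function.update (Function.update u i (u i * τ)) j (u j / τ))
      (Function.update (Function.update vv i (vv i * τ)) j (vv j / τ))
      (Function.update (Function.update m i (m i * τ)) j (m j / τ)) := by
  obtain ⟨hub, hu1, hvβ, hv1, hmb, hmu, hmv, hpu, hpv, hpg⟩ := hadm
  have hβ : 0 < β := hb.trans_le hbβ
  set u' := Function.update (Function.update u i (u i * τ)) j (u j / τ) with hu'
  set vv' := Function.update (Function.update vv i (vv i * τ)) j (vv j / τ) with hvv'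
  set m' := Function.update (Function.update m i (m i * τ)) j (m j / τ) with hm'
  have hi' : ∀ {f : ι → ℝ}, Function.update (Function.update f i (f i * τ)) j (f j / τ) i = f i * τ := fun {f} => by
    rw [Function.update_of_ne hij, Function.update_self]
  have hj' : ∀ {f : ι → ℝ}, Function.update (Function.update f i (f i * τ)) j (f j / τ) j = f j / τ := fun {f} => by
    rw [Function.update_self]
  have ho' : ∀ {f : ι → ℝ} (l : ι), l ≠ i → l ≠ j → Function.update (Function.update f i (f i * τ)) j (f j / τ) l = f l :=
    fun {f} l hli hlj => uExchange_apply_other τ hli hlj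
  -- products are unchanged
  have hprod : ∀ (f : ι → ℝ), (∀ l ∈ t, 0 < f l) →
      ∏ l ∈ t, Function.update (Function.update f i (f i * τ)) j (f j / τ) l = ∏ l ∈ t, f l := by
    intro f _
    have hjt : j ∈ t.erase i := mem_erase.2 ⟨hij.symm, hj⟩
    rw [← mul_prod_erase t _ hi, ← mul_prod_erase (t.erase i) _ hjt, ← mul_prod_erase t f hi,
      ← mul_prod_erase (t.erase i) f hjt, hi', hj']
    have hrest : ∏ l ∈ (t.erase i).erase j, Function.update (Function.update f i (f i * τ)) j (f j / τ) l =
        ∏ l ∈ (t.erase i).erase j, f l :=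
      prod_congr rfl fun l hl => ho' l (mem_erase.1 (mem_of_mem_erase hl)).1 (mem_erase.1 hl).1
    rw [hrest]
    field_simp
  have hmj' : b ≤ m j / τ := by rw [le_div_iff₀ hτ]; exact hmj
  have hvj' : β ≤ vv j / τ := by rw [le_div_iff₀ hτ]; exact hvj
  -- pointwise facts
  have hmb' : ∀ l ∈ t, b ≤ m' l := by
    intro l hl
    by_cases hli : l = i
    · rw [hli, hm', hi']; exact hmi
    by_cases hlj : l = j
    · rw [hlj, hm', hj']; exact hmj'
    rw [hm', ho' l hli hlj]; exact hmb l hl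
  have hvβ' : ∀ l ∈ t, β ≤ vv' l := by
    intro l hl
    by_cases hli : l = i
    · rw [hli, hvv', hi']; exact hvi
    by_cases hlj : l = j
    · rw [hlj, hvv', hj']; exact hvj'
    rw [hvv', ho' l hli hlj]; exact hvβ l hl
  have hmu' : ∀ l ∈ t, m' l ≤ u' l := by
    intro l hl
    by_cases hli : l = i
    · rw [hli, hm', hu', hi', hi']; exact mul_le_mul_of_nonneg_right (hmu i hi) hτ.le
    by_cases hlj : l = j
    · rw [hlj, hm', hu', hj', hj']; exact div_le_div_of_nonneg_right (hmu j hj) hτ.le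
    rw [hm', hu', ho' l hli hlj, ho' l hli hlj]; exact hmu l hl
  have hmv' : ∀ l ∈ t, m' l ≤ vv' l := by
    intro l hl
    by_cases hli : l = i
    · rw [hli, hm', hvv', hi', hi']; exact mul_le_mul_of_nonneg_right (hmv i hi) hτ.le
    by_cases hlj : l = j
    · rw [hlj, hm', hvv', hj', hj']; exact div_le_div_of_nonneg_right (hmv j hj) hτ.le
    rw [hm', hvv', ho' l hli hlj, ho' l hli hlj]; exact hmv l hl
  have hub' : ∀ l ∈ t, b ≤ u' l := fun l hl => (hmb' l hl).trans (hmu' l hl)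
  -- budgets
  have hpu' : ∏ l ∈ t, u' l ≤ b ^ (t.card - 1) := by
    rw [hu', hprod u fun l hl => hb.trans_le (hub l hl)]; exact hpu
  have hpv' : ∏ l ∈ t, vv' l ≤ β ^ (t.card - 1) * V := by
    rw [hvv', hprod vv fun l hl => hβ.trans_le (hvβ l hl)]; exact hpv
  have hpg' : ∏ l ∈ t, ((1 - s) * m' l + s * vv' l) ≤ ((1 - s) * b + s * β) ^ (t.card - 1) * V := by
    have e : ∀ l ∈ t, (1 - s) * m' l + s * vv' l =
        Function.update (Function.update (fun l => (1 - s) * m l + s * vv l) i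
          ((fun l => (1 - s) * m l + s * vv l) i * τ)) j ((fun l => (1 - s) * m l + s * vv l) j / τ) l := by
      intro l _
      by_cases hli : l = i
      · rw [hli, hm', hvv', hi', hi', hi']; ring
      by_cases hlj : l = j
      · rw [hlj, hm', hvv', hj', hj', hj']; ring
      rw [hm', hvv', ho' l hli hlj, ho' l hli hlj, ho' l hli hlj]
    rw [prod_congr rfl e]
    by_cases hdeg : ∀ l ∈ t, 0 < (1 - s) * m l + s * vv l
    · rw [hprod _ hdeg]; exact hpg
    · -- degenerate (some g_l ≤ 0 is impossible unless the data are degenerate): fall back to the direct computation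
      push Not at hdeg
      obtain ⟨l, hl, hle⟩ := hdeg
      -- g_l ≥ 0 always? only with s ∈ [0,1]; we do not have it here, so use the product identity without positivity:
      have hjt : j ∈ t.erase i := mem_erase.2 ⟨hij.symm, hj⟩
      have key : ∏ l ∈ t, Function.update (Function.update (fun l => (1 - s) * m l + s * vv l) i
          ((fun l => (1 - s) * m l + s * vv l) i * τ)) j ((fun l => (1 - s) * m l + s * vv l) j / τ) l =
          ∏ l ∈ t, ((1 - s) * m l + s * vv l) := by
        rw [← mul_prod_erase t _ hi, ← mul_prod_erase (t.erase i) _ hjt,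
          ← mul_prod_erase t (fun l => (1 - s) * m l + s * vv l) hi,
          ← mul_prod_erase (t.erase i) (fun l => (1 - s) * m l + s * vv l) hjt, hi', hj']
        have hrest : ∏ l ∈ (t.erase i).erase j, Function.update (Function.update (fun l => (1 - s) * m l + s * vv l) i
            ((fun l => (1 - s) * m l + s * vv l) i * τ)) j ((fun l => (1 - s) * m l + s * vv l) j / τ) l =
            ∏ l ∈ (t.erase i).erase j, ((1 - s) * m l + s * vv l) :=
          prod_congr rfl fun l hl => ho' l (mem_erase.1 (mem_of_mem_erase hl)).1 (mem_erase.1 hl).1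
        rw [hrest]
        field_simp
      rw [key]; exact hpg
  refine ⟨hub', ?_, hvβ', ?_, hmb', hmu', hmv', hpu', hpv', hpg'⟩
  · intro l hl
    exact le_cap_of_prod_le hb hub' (by rw [mul_one]; exact hpu') hl
  · intro l hl
    exact le_cap_of_prod_le hβ hvβ' hpv' hl

/-- **The scaling move: a coefficient at `τ = 1` is at most the larger of the coefficients at the endpoints.** [this work] -/
theorem coeff_scale_le_max [DecidableEq ι] {s : ℝ} (hs0 : 0 ≤ s) (hs1 : s ≤ 1) {t : Finset ι} {u vv m : ι → ℝ}
    (hu : ∀ l ∈ t, 0 ≤ u l) (hm : ∀ l ∈ t, 0 ≤ m l) (hv : ∀ l ∈ t, 0 ≤ vv l) {i j : ι} (hij : i ≠ j) (hi : i ∈ t)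
    (hj : j ∈ t) {tlo thi : ℝ} (hlo : 0 < tlo) (hlo1 : tlo ≤ 1) (hhi : 1 ≤ thi) (k : ℕ) :
    (prodPoly t (fun l => s + (1 - s) * u l) (fun l => (1 - s) * m l + s * vv l)).coeff k ≤
      max ((prodPoly t (fun l => s + (1 - s) * Function.update (Function.update u i (u i * tlo)) j (u j / tlo) l)
            (fun l => (1 - s) * Function.update (Function.update m i (m i * tlo)) j (m j / tlo) l +
              s * Function.update (Function.update vv i (vv i * tlo)) j (vv j / tlo) l)).coeff k)
        ((prodPoly t (fun l => s + (1 - s) * Function.update (Function.update u i (u i * thi)) j (u j / thi) l)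
            (fun l => (1 - s) * Function.update (Function.update m i (m i * thi)) j (m j / thi) l +
              s * Function.update (Function.update vv i (vv i * thi)) j (vv j / thi) l)).coeff k) := by
  have hs' : 0 ≤ 1 - s := sub_nonneg.2 hs1
  have hjt : j ∈ t.erase i := mem_erase.2 ⟨hij.symm, hj⟩
  have hit : i ∉ t.erase i := notMem_erase i t
  have hjt' : j ∉ (t.erase i).erase j := notMem_erase j _
  set c : ι → ℝ := fun l => (1 - s) * m l + s * vv l with hcd
  have hc : ∀ l ∈ t, 0 ≤ c l := fun l hl => add_nonneg (mul_nonneg hs' (hm l hl)) (mul_nonneg hs0 (hv l hl))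
  set R := prodPoly ((t.erase i).erase j) (fun l => s + (1 - s) * u l) c with hRd
  have hR : CoefNonneg R := coefNonneg_prodPoly _
    (fun l hl => add_nonneg hs0 (mul_nonneg hs' (hu l (mem_of_mem_erase (mem_of_mem_erase hl))))) 
    (fun l hl => hc l (mem_of_mem_erase (mem_of_mem_erase hl)))
  have ho' : ∀ {f : ι → ℝ} (τ : ℝ) (l : ι), l ≠ i → l ≠ j →
      Function.update (Function.update f i (f i * τ)) j (f j / τ) l = f l :=
    fun {f} τ l hli hlj => uExchange_apply_other τ hli hlj
  have fac : ∀ τ : ℝ, τ ≠ 0 →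
      prodPoly t (fun l => s + (1 - s) * Function.update (Function.update u i (u i * τ)) j (u j / τ) l)
          (fun l => (1 - s) * Function.update (Function.update m i (m i * τ)) j (m j / τ) l +
            s * Function.update (Function.update vv i (vv i * τ)) j (vv j / τ) l) =
        (C ((s ^ 2 + (1 - s) ^ 2 * (u i * u j)) + s * (1 - s) * u i * τ + s * (1 - s) * u j / τ) * X ^ 2 +
          C ((1 - s) * (u i * c j + u j * c i) + s * c i * τ + s * c j / τ) * X +
          C (c i * c j + 0 * τ + 0 / τ)) * R := by
    intro τ hτ
    have hrest : prodPoly ((t.erase i).erase j)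
        (fun l => s + (1 - s) * Function.update (Function.update u i (u i * τ)) j (u j / τ) l)
        (fun l => (1 - s) * Function.update (Function.update m i (m i * τ)) j (m j / τ) l +
          s * Function.update (Function.update vv i (vv i * τ)) j (vv j / τ) l) = R :=
      prodPoly_congr
        (fun l hl => by rw [ho' τ l (mem_erase.1 (mem_of_mem_erase hl)).1 (mem_erase.1 hl).1])
        (fun l hl => by
          rw [ho' τ l (mem_erase.1 (mem_of_mem_erase hl)).1 (mem_erase.1 hl).1,
            ho' τ l (mem_erase.1 (mem_of_mem_erase hl)).1 (mem_erase.1 hl).1])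
    rw [← insert_erase hi, prodPoly_insert hit, ← insert_erase hjt, prodPoly_insert hjt', hrest, ← mul_assoc,
      lin_mul_lin]
    simp only [Function.update_self, Function.update_of_ne hij]
    have e2 : (s + (1 - s) * (u i * τ)) * (s + (1 - s) * (u j / τ)) =
        (s ^ 2 + (1 - s) ^ 2 * (u i * u j)) + s * (1 - s) * u i * τ + s * (1 - s) * u j / τ := by
      field_simp; ring
    have e1 : (s + (1 - s) * (u i * τ)) * ((1 - s) * (m j / τ) + s * (vv j / τ)) +
        ((1 - s) * (m i * τ) + s * (vv i * τ)) * (s + (1 - s) * (u j / τ)) =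
        (1 - s) * (u i * c j + u j * c i) + s * c i * τ + s * c j / τ := by
      rw [hcd]; field_simp; ring
    have e0 : ((1 - s) * (m i * τ) + s * (vv i * τ)) * ((1 - s) * (m j / τ) + s * (vv j / τ)) =
        c i * c j + 0 * τ + 0 / τ := by
      rw [hcd]; field_simp; ring
    rw [e2, e1, e0]
  have fac1 : prodPoly t (fun l => s + (1 - s) * u l) c =
      (C ((s ^ 2 + (1 - s) ^ 2 * (u i * u j)) + s * (1 - s) * u i + s * (1 - s) * u j) * X ^ 2 +
        C ((1 - s) * (u i * c j + u j * c i) + s * c i + s * c j) * X + C (c i * c j + 0 + 0)) * R := by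
    have h := fac 1 one_ne_zero
    simp only [mul_one, div_one, Function.update_eq_self] at h
    exact h
  rw [fac1, fac tlo hlo.ne', fac thi (by linarith)]
  exact coeff_quad_mul_le_max hR k (mul_nonneg (mul_nonneg hs0 hs') (hu j hj)) (mul_nonneg hs0 (hc j hj)) le_rfl
    hlo hlo1 hhi

end LinkedCurrency

end SafeCalc

end Summit.CriticalPhenomena.PercolationContinuityZ3.Theorems.SunflowerPartition
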